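import Summits.BirchSwinnertonDyer.BirchSwinnertonDyer.Theorems.ErratumRoadFiveEulerHalfNotRamPAnchorResidual
import Summits.BirchSwinnertonDyer.BirchSwinnertonDyer.Theorems.ErratumRoadFiveEulerHalfJetchevMaxHLAtPSwapStub
import Summits.BirchSwinnertonDyer.BirchSwinnertonDyer.Theorems.ErratumRoadFiveEulerHalfNotRamSplitSetRoad
import Summits.BirchSwinnertonDyer.BirchSwinnertonDyer.Theorems.SchneiderFreeAdditiveX3PoitouTateReciprocitySumHolds
import Summits.BirchSwinnertonDyer.Rank1Residual.X11b.BDPRouteTamagawaSupport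
import HarnessLib

/-!
# Route `ErratumRoadFive` (K2, `p ≥ 5`), crux `EulerHalfNotRamNoInertSetAtFive` (item stmt-BirchSwinnertonDyer-19715), line `birth`:
# THE COMPOSITION OF THE LINE AS AN IMPORTABLE THEOREM — the ROUTE DECL BY NAME from the six route items, the two printed facts
# (Gross 1991 Prop. 3.7 (2) image-free, Gross 1991 §6 ∕ [GZ86 III (3.1)] `E⁰`) and the LAB text (HOLE 1, (B6) at the carrier primes); and the
# grade-aware form of the skeleton v13 (`Cruxes/EulerHalfNotRamNoInertSetAtFive/Lines/birth.lean`, LEAD `bsd-line-er5-p1` g1, sha16 e22c4efb6459b04e)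
# with the HELD split primitives routing the split-set pairs first
# (cell `bsd-stepL`, width seat `bsd-line-er5-p1-w2` g3; `--supports stmt-BirchSwinnertonDyer-19715 --as helper`)

WHAT. Three sorry-free theorems, every input a NAMED binder (route items of `Theses.ErratumRoadFive` by name, Literature named facts by name,
the LAB text = the registered stub `stub_shimuraCarrierLabelsB6AtFive` of v10–v13 VERBATIM as a binder type; no definition introduced):

* `res_pOnlyMultCarrierAtFive_of_items_of_twoPrintFacts` — S1b (the exceptional-zero core: `p` the ONLY multiplicative prime, split,
  `p ∣ ord_p Δ_min`; registered text VERBATIM as conclusion) from the items `PublishedInputsFive`, `X11aLowerHalf`, `ShimuraCasselsTateLevelInputs`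
  and the TWO printed facts — the skeleton's `Birth.res_pOnlyMultCarrierAtFive_of_printFacts` with the items BY NAME, over the lead g0's
  `JetchevMaxHLAtP.res_pOnlyMultCarrierAtFive_of_swapPrintFacts_of_lowerX11a` (p615583 ∕ -w2 g0's swap end p616221); conjunct (2) of the old
  three-fact bundle (`SelmerComplement` of THE canonical invariant maps) is the KERNEL theorem
  `SchneiderFreeAdditiveX3.PoitouTateReduction.selmerComplement_canonical_holds` (cell bsd-schneider, p626891; RULING 60 (b), the F2 fold).
* `eulerHalfNotRamNoInertSetAtFive_of_items_of_twoPrintFacts_of_LAB` — **the crux BY NAME from the six items + the two printed facts + LAB,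
  and NOTHING ELSE**: a pair whose only multiplicative prime is `p` is a carrier pair (`p ≥ 5`, `p ∣ ∏c` ⟹ a split carrier, which is multiplicative,
  hence `= p`: `X11b.dvd_tamagawaProduct_iff_exists_split`), served by S1b; a pair with a multiplicative `ℓ ≠ p` is served by the LEAD's `p`-ANCHOR
  `EulerHalfPAnchor.eulerHalfNotRam_otherMult_of_items_of_LAB` (p630971). The HELD split primitives
  `shimuraCurve_heegnerSystem_primitivesSplitReduced` are NOT a hypothesis: logically the split-set road is subsumed by the `p`-anchor once LAB is
  granted (the LEAD's FINAL-STATE note (iii): the skeleton keeps the road so that the 69 split-set census pairs stay at HELD-print grade rather than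
  LAB grade — a GRADE choice, not a logical need; this theorem records the logical minimum).
* `eulerHalfNotRamNoInertSetAtFive_of_items_of_HELD_of_twoPrintFacts_of_LAB` — the GRADE-AWARE composition = v13's
  `Birth.EulerHalfNotRamNoInertSetAtFive_of` VERBATIM in its case order (split-set datum ⟹ the STUB-LANDED road
  `EulerHalfSplitTwinRoad.stub_splitSetRoadAtFive`, p611250, on the items + HELD; else `p` only multiplicative ⟹ S1b; else the `p`-anchor), so that
  the registered line's end state is a BUILD-maintained kernel theorem importable by the eventual closer and by the sibling consumers of LAB
  (19065 `hybrid`, 19109 `inert`, 21420), not only a farm-elaborated crux workfile.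

WHY (width seat -w2 g3, 2026-08-28). After v13 the line has no kernel-able stub left (its three stubs are the two printed facts, LAB = the cell's
common (B6)@carriers object — PROOF-B6 written proof of record, referee PASS, RULING 57 — and the HELD printed primitives). Crux workfiles are not
importable and are not rebuilt with the tree; this file puts the composition where the build maintains it. If the three inputs are ever discharged
(`theorem …_holds`), the crux closes by a five-line file applying `eulerHalfNotRamNoInertSetAtFive_of_items_of_twoPrintFacts_of_LAB`.

HONEST FRAMING: THEOREMS ONLY, CONDITIONAL on their displayed hypotheses — six route items (three of them OPEN items of their own: 19064
`X11aLowerHalf` is a crux), two printed named facts (typed, not proved; XL), and the LAB text (beyond print in the kernel; written proof PROOF-B6 on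
paper). No `sorry`, no definition, no new named fact, no stub credit claimed (`--as helper`); item 19715 is NOT closed; no census number moves; BSD is
proved for no curve; no summit statement is touched.
[cite: Jetchev2008, Thm. 1.1, Thm. 1.4, Cor. 1.5] [cite: PastenShimura2024, Prop. 6.13, Lemma 6.15, Lemma 6.18, §6.6]
[cite: GrossLMS1991, Prop. 3.7 (2) (p. 240), §6 proof of Prop. 6.2 (1) (p. 245)] [cite: GrossZagier1986Heegner, III (3.1)]
[cite: McCallumLMS1991, Cor. 5.6] [cite: MilneADT2006, Ch. I Thm. 4.10(b)] [cite: SilvermanATAEC1994, Cor. IV.9.2 (d), Table 4.1]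
[cite: CaiShuTian2014, Thm. 1.5] [cite: PapikianRabinoff2016, Cor. 3.5]
-/

set_option autoImplicit false
set_option linter.dupNamespace false

noncomputable section

open scoped Classical

namespace Summit.BirchSwinnertonDyer.BirchSwinnertonDyer.Theorems.EulerHalfBirthAssembly

open Summit.BirchSwinnertonDyer.BirchSwinnertonDyer.Theses.ErratumRoadFive
open Literature.NumberTheory.EllipticCurves Literature.NumberTheory.EllipticCurves.Rank1Residual
open Summit.BirchSwinnertonDyer.Rank1Residual

/-- **S1b BY NAME — the exceptional-zero core of crux 19715 (`p` the ONLY multiplicative prime, split, `p ∣ ord_p Δ_min`; v2b′'s registered text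
VERBATIM as conclusion) from the route items `PublishedInputsFive`, `X11aLowerHalf`, `ShimuraCasselsTateLevelInputs` and the TWO printed facts**
Gross 1991 Prop. 3.7 (2) image-free and Gross 1991 §6 ∕ [GZ86 III (3.1)] `E⁰`. The lead g0's `JetchevMaxHLAtP.res_pOnlyMultCarrierAtFive_of_swapPrintFacts_of_lowerX11a`
(Jetchev Thm. 1.4 max form at `p` by -w2 g0's swap end; McCallum Cor. 5.6 upper via Cassels–Tate) fed with the items' conjuncts; the `SelmerComplement` of
THE canonical local invariant maps is the kernel theorem `selmerComplement_canonical_holds`. CONDITIONAL on the displayed inputs; no pair is booked.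
[cite: Jetchev2008, Thm. 1.4, Cor. 1.5] [cite: McCallumLMS1991, Cor. 5.6] [cite: GrossLMS1991, Prop. 3.7 (2), §6 Prop. 6.2 (1)] [cite: MilneADT2006, Ch. I Thm. 4.10(b)] -/
theorem res_pOnlyMultCarrierAtFive_of_items_of_twoPrintFacts
    (h₅ : PublishedInputsFive) (h₃ : X11aLowerHalf) (hCTi : ShimuraCasselsTateLevelInputs)
    (hF₁ : GrossLMS1991.prop37_2_frobeniusCongruence)
    (hF₃ : Gross1991_heegnerPoint_sub_ratTorsion_mem_E0) :
    ∀ (W : WeierstrassCurve ℚ) [W.IsElliptic] [W.IsGloballyMinimal] (p : ℕ) [Fact p.Prime],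
      ClassX11b W p → 5 ≤ p → Surj W p → ¬ Ram W p → p ∣ W.tamagawaProduct →
      (∀ (ℓ : ℕ) [Fact ℓ.Prime], W.HasMultiplicativeReductionAtPrime ℓ → ℓ = p) →
      W.HasSplitMultiplicativeReductionAtPrime p → p ∣ padicValInt p W.minimalDiscriminantInt →
      Typed.MissingUpperBoundAt W p := by
  obtain ⟨hGZ, hKo, -, -, -, hGZK, hmod, hnf, hHL, -, hMaz, -, -, -, -⟩ := h₅
  exact JetchevMaxHLAtP.res_pOnlyMultCarrierAtFive_of_swapPrintFacts_of_lowerX11a hGZ hKo hGZK hmod hnf hHL hMaz hCTi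
    ⟨hF₁, fun K _ _ n _ ↦ SchneiderFreeAdditiveX3.PoitouTateReduction.selmerComplement_canonical_holds K n, hF₃⟩
    (fun Wd _ _ p _ hXa ↦ h₃ Wd p hXa)

/-- **CRUX 19715 BY NAME FROM THE SIX ROUTE ITEMS + THE TWO PRINTED FACTS + LAB, AND NOTHING ELSE.** `Theses.ErratumRoadFive.EulerHalfNotRamNoInertSetAtFive`
from `PublishedInputsFive` (19066), `X11aLowerHalf` (19064), `ShimuraParametrizationDataNonempty` (19524), `PastenComponentOrdersInput`,
`ShimuraCasselsTateLevelInputs`, `ShimuraHeegnerEulerSystemInertPrintedR` (the binders `h₅ h₃ hJL hCO hCTi hESi` of `closes`), Gross 1991 Prop. 3.7 (2)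
image-free, Gross §6 ∕ [GZ86 III (3.1)] `E⁰`, and the LAB text (v10–v13's registered `stub_shimuraCarrierLabelsB6AtFive` VERBATIM: the labelled CM family of
`X_{N⁺,N⁻}` with (B6) only at the carrier primes outside `S`). PROOF: if every multiplicative prime is `p`, then `p ∣ ∏c` with `p ≥ 5` makes the place over
`p` a split carrier (`X11b.dvd_tamagawaProduct_iff_exists_split`) and S1b applies; otherwise the LEAD's `p`-anchor `EulerHalfPAnchor.eulerHalfNotRam_otherMult_of_items_of_LAB`
(the `SelmerComplement` binder discharged by the kernel theorem). The crux's own hypotheses «`p ∣ ∏c`» and «no inert-set datum» are used only through the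
first. The HELD split primitives are NOT needed (grade remark in the module docstring). CONDITIONAL on the displayed inputs; item 19715 is NOT closed by this
helper; BSD is proved for no curve. [cite: Jetchev2008, Thm. 1.1, Thm. 1.4, Cor. 1.5] [cite: PastenShimura2024, Prop. 6.13, Lemma 6.18, §6.6]
[cite: SilvermanATAEC1994, Cor. IV.9.2 (d)] -/
theorem eulerHalfNotRamNoInertSetAtFive_of_items_of_twoPrintFacts_of_LAB
    (h₅ : PublishedInputsFive) (h₃ : X11aLowerHalf) (hJL : ShimuraParametrizationDataNonempty)
    (hCO : PastenComponentOrdersInput) (hCTi : ShimuraCasselsTateLevelInputs)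
    (hESi : ShimuraHeegnerEulerSystemInertPrintedR)
    (hF₁ : GrossLMS1991.prop37_2_frobeniusCongruence)
    (hF₃ : Gross1991_heegnerPoint_sub_ratTorsion_mem_E0)
    (hLabT : ∀ (W : WeierstrassCurve ℚ) [W.IsElliptic] [W.IsGloballyMinimal] (p : ℕ) [Fact p.Prime],
      Summit.BirchSwinnertonDyer.Rank1Residual.ClassX11b W p → 5 ≤ p →
      ∀ (N : ℕ) [NeZero N] (K : Type) [Field K] [NumberField K] (S : Finset ℕ)
        (Dt : Literature.NumberTheory.EllipticCurves.ModularForms.ModularParametrizationData W N)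
        (X : Literature.NumberTheory.Automorphic.ShimuraCurveData (∏ q ∈ S, q) (N / ∏ q ∈ S, q)) (W' : WeierstrassCurve ℚ) [W'.IsElliptic]
        (P₀ : Literature.NumberTheory.Automorphic.ShimuraParametrizationData X W'),
        W.conductorNorm ℤ = N → Literature.NumberTheory.EllipticCurves.IsImaginaryQuadratic K → NumberField.discr K < -4 → Even S.card →
        (∀ ℓ ∈ S, ℓ.Prime ∧ ℓ ∣ N ∧ ¬ ℓ ^ 2 ∣ N ∧
          ((Ideal.span {(ℓ : ℤ)}).primesOver (NumberField.RingOfIntegers K)).ncard = 1 ∧ ¬ (ℓ : ℤ) ∣ NumberField.discr K) →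
        (∀ ℓ : ℕ, ℓ.Prime → ℓ ∣ N → ℓ ∉ S → ((Ideal.span {(ℓ : ℤ)}).primesOver (NumberField.RingOfIntegers K)).ncard = 2) →
        p ∈ S → ¬ (p : ℤ) ∣ Dt.c → P₀.IsMinimalFor W →
        ∃ (ι : K →+* ℂ) (y : (W.baseChange K).toAffine.Point) (degy : ℕ)
          (ys : (m : ℕ) → (W.baseChange (Literature.NumberTheory.EllipticCurves.ringClassField K ι m)).toAffine.Point) (ε : ℤ), 0 < degy ∧
          padicValNat p degy = padicValNat p P₀.deg ∧
          Literature.NumberTheory.EllipticCurves.LDerivEK W K = 8 * (Real.pi : ℂ) ^ 2 *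
              Literature.NumberTheory.EllipticCurves.ModularForms.peterssonProduct (CongruenceSubgroup.Gamma0 N) 2 Dt.f Dt.f /
              ((((NumberField.Units.torsionOrder K : ℝ) / 2) ^ 2 * √|(NumberField.discr K : ℝ)| : ℝ) : ℂ) *
            ((y.canonicalHeight : ℂ) / (degy : ℂ)) ∧
          (¬ IsOfFinAddOrder y → 0 < (AddSubgroup.zmultiples y).index) ∧
          Summit.BirchSwinnertonDyer.BirchSwinnertonDyer.Theorems.ShimuraWalk.LabelsAt W N K ι y ys ε ∧
          ∀ (q : ℕ) [Fact q.Prime], q ∣ N → q ∉ S → p ∣ (W.baseChange ℚ_[q]).localTamagawaNumber ℤ_[q] →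
            Literature.NumberTheory.EllipticCurves.ShimuraCMFamily.LabelB6 ι W N {q} ys) :
    EulerHalfNotRamNoInertSetAtFive := by
  intro W _ _ p _ hX hp5 hsurj hram htam _hno
  by_cases h : ∀ (ℓ : ℕ) [Fact ℓ.Prime], W.HasMultiplicativeReductionAtPrime ℓ → ℓ = p
  · -- `p` is the only multiplicative prime: the split carrier that `p ∣ ∏c` provides is multiplicative, hence it is `p`
    obtain ⟨ℓ, hℓ, hsplit, hdvd⟩ := (X11b.dvd_tamagawaProduct_iff_exists_split (W := W) (Fact.out : p.Prime) hp5).mp htam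
    have hℓp : ℓ = p := h ℓ hsplit.hasMultiplicativeReductionAtPrime
    subst hℓp
    exact res_pOnlyMultCarrierAtFive_of_items_of_twoPrintFacts h₅ h₃ hCTi hF₁ hF₃ W _ hX hp5 hsurj hram htam h hsplit hdvd
  · have hother : ∃ (ℓ : ℕ) (_ : Fact ℓ.Prime), ℓ ≠ p ∧ W.HasMultiplicativeReductionAtPrime ℓ := by
      by_contra hc
      exact h fun ℓ _ hm ↦ by_contra fun hne ↦ hc ⟨ℓ, ‹_›, hne, hm⟩
    exact EulerHalfPAnchor.eulerHalfNotRam_otherMult_of_items_of_LAB h₅ h₃ hJL hCO hCTi hESi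
      (fun K _ _ n _ ↦ SchneiderFreeAdditiveX3.PoitouTateReduction.selmerComplement_canonical_holds K n) hLabT
      W p hX hp5 hsurj hram hother

/-- **THE GRADE-AWARE COMPOSITION OF THE REGISTERED LINE (v13 `Birth.EulerHalfNotRamNoInertSetAtFive_of` VERBATIM in its case order), importable.**
`Theses.ErratumRoadFive.EulerHalfNotRamNoInertSetAtFive` from the six route items + the HELD split primitives `shimuraCurve_heegnerSystem_primitivesSplitReduced`
+ the two printed facts + LAB: a pair WITH a split-set datum (even `S ∌ p` of multiplicative primes, every split `ℓ ∉ S` with `p ∤ ord_ℓ Δ_min`, a (W)-witness or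
a half `R` of primes `q` with `p ∤ q − 1`) is served by the STUB-LANDED split-set road `EulerHalfSplitTwinRoad.stub_splitSetRoadAtFive` (p611250; items + HELD
only — the 69 road census pairs stay at print grade); a pair without one whose only multiplicative prime is `p` is a carrier pair (else `S = R = ∅` is a datum)
⟹ S1b; otherwise the `p`-anchor on LAB. CONDITIONAL on the displayed inputs; no stub credit; item 19715 is NOT closed by this helper; BSD is proved for no curve.
[cite: PastenShimura2024, Lemma 6.15, Lemma 6.16, Lemma 6.18, §6.6] [cite: PapikianRabinoff2016, Cor. 3.5] [cite: Jetchev2008, Thm. 1.1, Thm. 1.4, Cor. 1.5] -/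
theorem eulerHalfNotRamNoInertSetAtFive_of_items_of_HELD_of_twoPrintFacts_of_LAB
    (h₅ : PublishedInputsFive) (h₃ : X11aLowerHalf) (hJL : ShimuraParametrizationDataNonempty)
    (hCO : PastenComponentOrdersInput) (hCTi : ShimuraCasselsTateLevelInputs)
    (hESi : ShimuraHeegnerEulerSystemInertPrintedR)
    (hLabS : shimuraCurve_heegnerSystem_primitivesSplitReduced)
    (hF₁ : GrossLMS1991.prop37_2_frobeniusCongruence)
    (hF₃ : Gross1991_heegnerPoint_sub_ratTorsion_mem_E0)
    (hLabT : ∀ (W : WeierstrassCurve ℚ) [W.IsElliptic] [W.IsGloballyMinimal] (p : ℕ) [Fact p.Prime],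
      Summit.BirchSwinnertonDyer.Rank1Residual.ClassX11b W p → 5 ≤ p →
      ∀ (N : ℕ) [NeZero N] (K : Type) [Field K] [NumberField K] (S : Finset ℕ)
        (Dt : Literature.NumberTheory.EllipticCurves.ModularForms.ModularParametrizationData W N)
        (X : Literature.NumberTheory.Automorphic.ShimuraCurveData (∏ q ∈ S, q) (N / ∏ q ∈ S, q)) (W' : WeierstrassCurve ℚ) [W'.IsElliptic]
        (P₀ : Literature.NumberTheory.Automorphic.ShimuraParametrizationData X W'),
        W.conductorNorm ℤ = N → Literature.NumberTheory.EllipticCurves.IsImaginaryQuadratic K → NumberField.discr K < -4 → Even S.card →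
        (∀ ℓ ∈ S, ℓ.Prime ∧ ℓ ∣ N ∧ ¬ ℓ ^ 2 ∣ N ∧
          ((Ideal.span {(ℓ : ℤ)}).primesOver (NumberField.RingOfIntegers K)).ncard = 1 ∧ ¬ (ℓ : ℤ) ∣ NumberField.discr K) →
        (∀ ℓ : ℕ, ℓ.Prime → ℓ ∣ N → ℓ ∉ S → ((Ideal.span {(ℓ : ℤ)}).primesOver (NumberField.RingOfIntegers K)).ncard = 2) →
        p ∈ S → ¬ (p : ℤ) ∣ Dt.c → P₀.IsMinimalFor W →
        ∃ (ι : K →+* ℂ) (y : (W.baseChange K).toAffine.Point) (degy : ℕ)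
          (ys : (m : ℕ) → (W.baseChange (Literature.NumberTheory.EllipticCurves.ringClassField K ι m)).toAffine.Point) (ε : ℤ), 0 < degy ∧
          padicValNat p degy = padicValNat p P₀.deg ∧
          Literature.NumberTheory.EllipticCurves.LDerivEK W K = 8 * (Real.pi : ℂ) ^ 2 *
              Literature.NumberTheory.EllipticCurves.ModularForms.peterssonProduct (CongruenceSubgroup.Gamma0 N) 2 Dt.f Dt.f /
              ((((NumberField.Units.torsionOrder K : ℝ) / 2) ^ 2 * √|(NumberField.discr K : ℝ)| : ℝ) : ℂ) *
            ((y.canonicalHeight : ℂ) / (degy : ℂ)) ∧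
          (¬ IsOfFinAddOrder y → 0 < (AddSubgroup.zmultiples y).index) ∧
          Summit.BirchSwinnertonDyer.BirchSwinnertonDyer.Theorems.ShimuraWalk.LabelsAt W N K ι y ys ε ∧
          ∀ (q : ℕ) [Fact q.Prime], q ∣ N → q ∉ S → p ∣ (W.baseChange ℚ_[q]).localTamagawaNumber ℤ_[q] →
            Literature.NumberTheory.EllipticCurves.ShimuraCMFamily.LabelB6 ι W N {q} ys) :
    EulerHalfNotRamNoInertSetAtFive := by
  intro W _ _ p _ hX hp5 hsurj hram htam _hno
  by_cases hD : ∃ S : Finset ℕ, (∀ ℓ ∈ S, ∃ _ : Fact ℓ.Prime, Mult W ℓ) ∧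
      Even S.card ∧ p ∉ S ∧
      (∀ (ℓ : ℕ) [Fact ℓ.Prime], ℓ ∉ S → W.HasSplitMultiplicativeReductionAtPrime ℓ → ¬ p ∣ padicValInt ℓ W.minimalDiscriminantInt) ∧
      ((∃ (ℓ₀ : ℕ) (_ : Fact ℓ₀.Prime), Mult W ℓ₀ ∧ ℓ₀ ≠ p ∧
          ¬ p ∣ padicValInt ℓ₀ W.minimalDiscriminantInt) ∨
        ∃ R ⊆ S, S.card = 2 * R.card ∧ ∀ q ∈ R, ¬ p ∣ q - 1)
  · -- the split-set road (items + HELD)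
    exact EulerHalfSplitTwinRoad.stub_splitSetRoadAtFive h₅ h₃ hJL hCO hCTi hLabS W p hX hp5 hram hD
  by_cases h : ∀ (ℓ : ℕ) [Fact ℓ.Prime], W.HasMultiplicativeReductionAtPrime ℓ → ℓ = p
  · -- p is the only multiplicative prime: it is a carrier, for otherwise `S = R = ∅` is a split-set datum
    have hcar : W.HasSplitMultiplicativeReductionAtPrime p ∧ p ∣ padicValInt p W.minimalDiscriminantInt := by
      by_contra hnc
      apply hD
      refine ⟨∅, by simp, by simp, by simp, ?_, Or.inr ⟨∅, by simp, by simp, by simp⟩⟩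
      intro ℓ _ _ hsplit
      have hℓ : ℓ = p := h ℓ hsplit.hasMultiplicativeReductionAtPrime
      subst hℓ
      exact fun hdvd ↦ hnc ⟨hsplit, hdvd⟩
    exact res_pOnlyMultCarrierAtFive_of_items_of_twoPrintFacts h₅ h₃ hCTi hF₁ hF₃ W p hX hp5 hsurj hram htam h hcar.1 hcar.2
  · have hother : ∃ (ℓ : ℕ) (_ : Fact ℓ.Prime), ℓ ≠ p ∧ W.HasMultiplicativeReductionAtPrime ℓ := by
      by_contra hc
      exact h fun ℓ _ hm ↦ by_contra fun hne ↦ hc ⟨ℓ, ‹_›, hne, hm⟩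
    exact EulerHalfPAnchor.eulerHalfNotRam_otherMult_of_items_of_LAB h₅ h₃ hJL hCO hCTi hESi
      (fun K _ _ n _ ↦ SchneiderFreeAdditiveX3.PoitouTateReduction.selmerComplement_canonical_holds K n) hLabT
      W p hX hp5 hsurj hram hother

end Summit.BirchSwinnertonDyer.BirchSwinnertonDyer.Theorems.EulerHalfBirthAssembly

end
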